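import Mathlib.Analysis.SpecificLimits.Basic
import Summits.Ventures.HSemireg.WedgeHankelRecurrenceGaussZerosExtremeOffDiagonalStrict

/-!
# Venture HSemireg — **NEWTON'S METHOD FROM THE RIGHT CONVERGES TO THE LARGEST ZERO, MONOTONICALLY AND QUADRATICALLY**: for `P = ∏ (X − x_j)` with increasing zeros and `ξ > x_t`, the Newton
# image `N(ξ) = ξ − P(ξ)∕P'(ξ)` satisfies the EXACT identity `N(ξ) − x_t = (ξ − x_t)² s ∕ (1 + s (ξ − x_t))`, `s = Σ_{i<t} 1∕(ξ − x_i)`; hence `0 ≤ N(ξ) − x_t ≤ s₀ (ξ − x_t)²` with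
# `s₀ = Σ_{i<t} 1∕(x_t − x_i)` (quadratic convergence), `N(ξ) − x_t ≤ θ (ξ − x_t)` with `θ = c∕(1+c) < 1`, `c = Σ_{i<t} (ξ₀ − x_t)∕(ξ₀ − x_i)` for `ξ ≤ ξ₀` (linear rate), and the
# iterates from any `ξ₀ > x_t` decrease to `x_t`: `ξ_n − x_t ≤ θⁿ (ξ₀ − x_t)`, `ξ_n → x_t` (completing N339, which had the one-step invariant only)

HONEST FRAMING. Part of the Lean index of the computation cell `pub-hsemireg` (seat p10 gen 45, Sunday typer «UNIFORM-IN-n»).  Real polynomials, finite sums and one geometric limit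
(`tendsto_pow_atTop_nhds_zero_of_lt_one`) only; no variety, no cohomology theory, no sheaf, no Ext group and no semiregularity map is constructed here; nothing here says that HC / HC_CM / HC_AV
holds; no Literature fact (unproved `Prop`) is declared or used.  Custodian versions as in `WedgeHankelSiegelIdeal` (1/3).
SOURCES (cited).  J. Stoer, R. Bulirsch, *Introduction to Numerical Analysis* (3rd ed.) §5.5, Thm 5.5.5 and the proof of (5.5.7) (monotone convergence of Newton's method for polynomials with
real zeros from the right of the largest zero); A. M. Ostrowski, *Solution of Equations in Euclidean and Banach Spaces* (1973) Ch. 9; J. H. Wilkinson, *Rounding Errors in Algebraic Processes*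
(1963) Ch. 2 §§7–8 (the logarithmic derivative `P'∕P = Σ 1∕(ξ − x_i)`); G. H. Golub, J. H. Welsch, Math. Comp. 23 (1969) 221–230 (Newton on `q_{t+1}` for the Gauss nodes).
PROOF TYPED HERE.  `P'(ξ) = P(ξ) Σ_i 1∕(ξ − x_i)` (N334 `derivative_prod_X_sub_C_eq_sum` and `∏_{j≠i} = P∕(ξ − x_i)`); with `u = 1∕(ξ − x_t)` and `s` the rest, `N(ξ) − x_t = 1∕u − 1∕(u+s)`,
which `field_simp` turns into the displayed identity; `s ≤ s₀` and `s (ξ − x_t) ≤ c` termwise for `x_t < ξ ≤ ξ₀`; the iterates by induction (N339 `newton_step_of_strictMono_zeros` keeps them in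
`[x_t, ξ₀]`), the limit by squeezing against `θⁿ (ξ₀ − x_t)`.
DEDUP DISCLOSURE (`rg -n 'newton' Summits/Ventures/HSemireg Literature`, 2026-09-03): N339 `newton_step_mem` ∕ `newton_step_of_strictMono_zeros` (one step, no rate, no limit); Literature has
Newton SUMS ∕ identities only.  The 7 names below: 0 hits tree-wide.

WHAT IS IN THE TREE.  N334 `derivative_prod_X_sub_C_eq_sum`; N337 `eval_prod_X_sub_C_pos_of_gt`; N339 `eval_derivative_prod_pos_of_gt`, `newton_step_mem`, `newton_step_of_strictMono_zeros`;
Mathlib `tendsto_pow_atTop_nhds_zero_of_lt_one`, `tendsto_of_tendsto_of_tendsto_of_le_of_le`.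
THIS FILE (namespace `Summit.Ventures.HSemireg.Wedge.HankelOuter` continued; CHAINED on N349 (import only); 0 definitions):
* §1115 `eval_derivative_prod_eq_mul_sum_inv` (`P'(ξ) = P(ξ) Σ 1∕(ξ − x_i)` off the zeros), **`newton_step_sub_top_eq`** (the exact identity for `N(ξ) − x_t`), **`newton_step_quadratic`**
  (`0 ≤ N(ξ) − x_t ≤ s₀ (ξ − x_t)²`), **`newton_step_contraction`** (`N(ξ) − x_t ≤ (c∕(1+c)) (ξ − x_t)` for `x_t < ξ ≤ ξ₀`), `newton_iterates_mem` (`x_t ≤ ξ_n ≤ ξ₀`, `ξ_{n+1} ≤ ξ_n`),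
  **`newton_iterates_geometric`** (`ξ_n − x_t ≤ θⁿ (ξ₀ − x_t)`), **`newton_iterates_tendsto`** (`ξ_n → x_t`).
CAVEATS.  Exact arithmetic Newton (no rounding); starting point to the right of all zeros; for `t = 0` one step lands on the zero.  Nothing Ext-side.  New names only.
-/

open Module Polynomial Filter
open scoped Matrix Polynomial Topology

namespace Summit.Ventures.HSemireg.Wedge.HankelOuter

/-! ## §1115. Convergence of Newton's method from the right -/

/-- **The logarithmic derivative: `P'(ξ) = P(ξ) · Σ_i 1∕(ξ − z_i)`** for `P = ∏ (X − z_i)` and `ξ` not a zero. [Wilkinson 1963 Ch. 2 §7; this file, §1115] -/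
theorem eval_derivative_prod_eq_mul_sum_inv {n : ℕ} {z : Fin n → ℝ} {ξ : ℝ} (hξ : ∀ i, ξ ≠ z i) :
    (derivative (∏ i, (Polynomial.X - C (z i)))).eval ξ = (∏ i, (Polynomial.X - C (z i))).eval ξ * ∑ i, (ξ - z i)⁻¹ := by
  rw [derivative_prod_X_sub_C_eq_sum, eval_finsetSum, Finset.mul_sum]
  refine Finset.sum_congr rfl fun i _ => ?_
  have hfac : (Polynomial.X - C (z i)).eval ξ = ξ - z i := by rw [eval_sub, eval_X, eval_C]
  have hPi : (∏ j, (Polynomial.X - C (z j))).eval ξ = (ξ - z i) * (∏ j ∈ Finset.univ.erase i, (Polynomial.X - C (z j))).eval ξ := by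
    rw [← Finset.mul_prod_erase Finset.univ (fun j => Polynomial.X - C (z j)) (Finset.mem_univ i), eval_mul, hfac]
  rw [hPi, mul_right_comm, mul_inv_cancel₀ (sub_ne_zero.2 (hξ i)), one_mul]

/-- **THE EXACT NEWTON IDENTITY FROM THE RIGHT: `N(ξ) − x_t = (ξ − x_t)² · s ∕ (1 + s (ξ − x_t))`, `s = Σ_{i ≠ t} 1∕(ξ − x_i)`** (`P = ∏ (X − x_j)`, `x` increasing, `ξ > x_t`,
`N(ξ) = ξ − P(ξ)∕P'(ξ)`). [Stoer–Bulirsch §5.5 (proof of (5.5.7)); this file, §1115] -/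
theorem newton_step_sub_top_eq {P : ℝ[X]} {t : ℕ} {x : Fin (t + 1) → ℝ} (hx : StrictMono x) (hP : P = ∏ j, (Polynomial.X - C (x j))) {ξ : ℝ} (hξ : x (Fin.last t) < ξ) :
    ξ - P.eval ξ / (derivative P).eval ξ - x (Fin.last t) =
      (ξ - x (Fin.last t)) ^ 2 * (∑ i ∈ Finset.univ.erase (Fin.last t), (ξ - x i)⁻¹) / (1 + (∑ i ∈ Finset.univ.erase (Fin.last t), (ξ - x i)⁻¹) * (ξ - x (Fin.last t))) := by
  have hall : ∀ i, x i < ξ := fun i => (hx.monotone (Fin.le_last i)).trans_lt hξ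
  have hPpos : 0 < P.eval ξ := by rw [hP]; exact eval_prod_X_sub_C_pos_of_gt hall
  have hD : (derivative P).eval ξ = P.eval ξ * ∑ i, (ξ - x i)⁻¹ := by rw [hP]; exact eval_derivative_prod_eq_mul_sum_inv fun i => (hall i).ne'
  obtain ⟨s, hs⟩ : ∃ s : ℝ, s = ∑ i ∈ Finset.univ.erase (Fin.last t), (ξ - x i)⁻¹ := ⟨_, rfl⟩
  have hs0 : 0 ≤ s := by rw [hs]; exact Finset.sum_nonneg fun i _ => (inv_pos.2 (sub_pos.2 (hall i))).le
  have hu : 0 < ξ - x (Fin.last t) := sub_pos.2 hξ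
  have hsum : ∑ i, (ξ - x i)⁻¹ = (ξ - x (Fin.last t))⁻¹ + s := by
    rw [hs, ← Finset.add_sum_erase Finset.univ _ (Finset.mem_univ (Fin.last t))]
  rw [← hs, hD, hsum]
  have hne : (ξ - x (Fin.last t))⁻¹ + s ≠ 0 := (add_pos_of_pos_of_nonneg (inv_pos.2 hu) hs0).ne'
  field_simp
  ring

/-- **QUADRATIC CONVERGENCE: `0 ≤ N(ξ) − x_t ≤ s₀ · (ξ − x_t)²`, `s₀ = Σ_{i ≠ t} 1∕(x_t − x_i)`** (for `ξ > x_t`). [Stoer–Bulirsch §5.5; Ostrowski Ch. 9; this file, §1115] -/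
theorem newton_step_quadratic {P : ℝ[X]} {t : ℕ} {x : Fin (t + 1) → ℝ} (hx : StrictMono x) (hP : P = ∏ j, (Polynomial.X - C (x j))) {ξ : ℝ} (hξ : x (Fin.last t) < ξ) :
    0 ≤ ξ - P.eval ξ / (derivative P).eval ξ - x (Fin.last t) ∧
      ξ - P.eval ξ / (derivative P).eval ξ - x (Fin.last t) ≤ (∑ i ∈ Finset.univ.erase (Fin.last t), (x (Fin.last t) - x i)⁻¹) * (ξ - x (Fin.last t)) ^ 2 := by
  have hall : ∀ i, x i < ξ := fun i => (hx.monotone (Fin.le_last i)).trans_lt hξ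
  refine ⟨sub_nonneg.2 (newton_step_of_strictMono_zeros hx hP hξ).1, ?_⟩
  rw [newton_step_sub_top_eq hx hP hξ]
  obtain ⟨s, hs⟩ : ∃ s : ℝ, s = ∑ i ∈ Finset.univ.erase (Fin.last t), (ξ - x i)⁻¹ := ⟨_, rfl⟩
  have hs0 : 0 ≤ s := by rw [hs]; exact Finset.sum_nonneg fun i _ => (inv_pos.2 (sub_pos.2 (hall i))).le
  have hu : 0 < ξ - x (Fin.last t) := sub_pos.2 hξ
  -- `s ≤ s₀` termwise
  have hss : s ≤ ∑ i ∈ Finset.univ.erase (Fin.last t), (x (Fin.last t) - x i)⁻¹ := by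
    rw [hs]
    refine Finset.sum_le_sum fun i hi => ?_
    have hlt : x i < x (Fin.last t) := hx (lt_of_le_of_ne (Fin.le_last i) (Finset.ne_of_mem_erase hi))
    exact inv_anti₀ (sub_pos.2 hlt) (by linarith)
  rw [← hs]
  calc (ξ - x (Fin.last t)) ^ 2 * s / (1 + s * (ξ - x (Fin.last t))) ≤ (ξ - x (Fin.last t)) ^ 2 * s / 1 :=
        div_le_div_of_nonneg_left (mul_nonneg (sq_nonneg _) hs0) one_pos (le_add_of_nonneg_right (mul_nonneg hs0 hu.le))
    _ = s * (ξ - x (Fin.last t)) ^ 2 := by rw [div_one, mul_comm]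
    _ ≤ _ := mul_le_mul_of_nonneg_right hss (sq_nonneg _)

/-- **LINEAR RATE: for `x_t < ξ ≤ ξ₀`, `N(ξ) − x_t ≤ (c∕(1+c)) · (ξ − x_t)` with `c = Σ_{i ≠ t} (ξ₀ − x_t)∕(ξ₀ − x_i)`** (a contraction factor `< 1` depending only on the starting point).
[Stoer–Bulirsch Thm 5.5.5; this file, §1115] -/
theorem newton_step_contraction {P : ℝ[X]} {t : ℕ} {x : Fin (t + 1) → ℝ} (hx : StrictMono x) (hP : P = ∏ j, (Polynomial.X - C (x j))) {ξ ξ₀ : ℝ} (hξ : x (Fin.last t) < ξ) (hξ₀ : ξ ≤ ξ₀) :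
    ξ - P.eval ξ / (derivative P).eval ξ - x (Fin.last t) ≤
      ((∑ i ∈ Finset.univ.erase (Fin.last t), (ξ₀ - x (Fin.last t)) / (ξ₀ - x i)) / (1 + ∑ i ∈ Finset.univ.erase (Fin.last t), (ξ₀ - x (Fin.last t)) / (ξ₀ - x i))) * (ξ - x (Fin.last t)) := by
  have hall : ∀ i, x i < ξ := fun i => (hx.monotone (Fin.le_last i)).trans_lt hξ
  rw [newton_step_sub_top_eq hx hP hξ]
  obtain ⟨s, hs⟩ : ∃ s : ℝ, s = ∑ i ∈ Finset.univ.erase (Fin.last t), (ξ - x i)⁻¹ := ⟨_, rfl⟩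
  obtain ⟨c, hc⟩ : ∃ c : ℝ, c = ∑ i ∈ Finset.univ.erase (Fin.last t), (ξ₀ - x (Fin.last t)) / (ξ₀ - x i) := ⟨_, rfl⟩
  have hs0 : 0 ≤ s := by rw [hs]; exact Finset.sum_nonneg fun i _ => (inv_pos.2 (sub_pos.2 (hall i))).le
  have hu : 0 < ξ - x (Fin.last t) := sub_pos.2 hξ
  -- `s (ξ − x_t) ≤ c` termwise: `(ξ − x_t)∕(ξ − x_i) ≤ (ξ₀ − x_t)∕(ξ₀ − x_i)`
  have hsc : s * (ξ - x (Fin.last t)) ≤ c := by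
    rw [hs, hc, Finset.sum_mul]
    refine Finset.sum_le_sum fun i hi => ?_
    have hi' : x i ≤ x (Fin.last t) := hx.monotone (Fin.le_last i)
    have h1 : 0 < ξ - x i := sub_pos.2 (hall i)
    have h2 : 0 < ξ₀ - x i := by linarith
    rw [← div_eq_inv_mul, div_le_div_iff₀ h1 h2]
    nlinarith
  have hc0 : 0 ≤ c := (mul_nonneg hs0 hu.le).trans hsc
  rw [← hs, ← hc]
  -- `w ↦ w ∕ (1 + w)` is increasing
  have hmono : s * (ξ - x (Fin.last t)) / (1 + s * (ξ - x (Fin.last t))) ≤ c / (1 + c) := by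
    rw [div_le_div_iff₀ (by positivity) (by positivity)]
    nlinarith
  calc (ξ - x (Fin.last t)) ^ 2 * s / (1 + s * (ξ - x (Fin.last t))) = (s * (ξ - x (Fin.last t)) / (1 + s * (ξ - x (Fin.last t)))) * (ξ - x (Fin.last t)) := by ring
    _ ≤ c / (1 + c) * (ξ - x (Fin.last t)) := mul_le_mul_of_nonneg_right hmono hu.le

/-- **The Newton iterates from `ξ₀ > x_t` stay in `[x_t, ξ₀]` and decrease.** [Stoer–Bulirsch Thm 5.5.5; this file, §1115] -/
theorem newton_iterates_mem {P : ℝ[X]} {t : ℕ} {x : Fin (t + 1) → ℝ} (hx : StrictMono x) (hP : P = ∏ j, (Polynomial.X - C (x j)))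
    {ξ : ℕ → ℝ} (hξ0 : x (Fin.last t) < ξ 0) (hstep : ∀ n, ξ (n + 1) = ξ n - P.eval (ξ n) / (derivative P).eval (ξ n)) (n : ℕ) :
    x (Fin.last t) ≤ ξ n ∧ ξ n ≤ ξ 0 ∧ ξ (n + 1) ≤ ξ n := by
  have hroot : P.eval (x (Fin.last t)) = 0 := by
    rw [hP, eval_prod]; exact Finset.prod_eq_zero (Finset.mem_univ (Fin.last t)) (by rw [eval_sub, eval_X, eval_C, sub_self])
  -- one step from a point `≥ x_t`
  have hone : ∀ η, x (Fin.last t) ≤ η → x (Fin.last t) ≤ η - P.eval η / (derivative P).eval η ∧ η - P.eval η / (derivative P).eval η ≤ η := fun η hη => by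
    rcases hη.eq_or_lt with h | h
    · rw [← h, hroot, zero_div, sub_zero]; exact ⟨le_rfl, le_rfl⟩
    · obtain ⟨h1, h2, -⟩ := newton_step_of_strictMono_zeros hx hP h
      exact ⟨h1, h2.le⟩
  have key : ∀ n, x (Fin.last t) ≤ ξ n ∧ ξ n ≤ ξ 0 := by
    intro n
    induction n with
    | zero => exact ⟨hξ0.le, le_rfl⟩
    | succ n ih =>
      obtain ⟨h1, h2⟩ := hone (ξ n) ih.1
      rw [← hstep n] at h1 h2
      exact ⟨h1, h2.trans ih.2⟩
  obtain ⟨-, h2⟩ := hone (ξ n) (key n).1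
  rw [← hstep n] at h2
  exact ⟨(key n).1, (key n).2, h2⟩

/-- **GEOMETRIC DECAY OF THE NEWTON ERROR: `ξ_n − x_t ≤ θⁿ (ξ₀ − x_t)`, `θ = c∕(1+c)`, `c = Σ_{i ≠ t} (ξ₀ − x_t)∕(ξ₀ − x_i)`.** [Stoer–Bulirsch Thm 5.5.5; this file, §1115] -/
theorem newton_iterates_geometric {P : ℝ[X]} {t : ℕ} {x : Fin (t + 1) → ℝ} (hx : StrictMono x) (hP : P = ∏ j, (Polynomial.X - C (x j)))
    {ξ : ℕ → ℝ} (hξ0 : x (Fin.last t) < ξ 0) (hstep : ∀ n, ξ (n + 1) = ξ n - P.eval (ξ n) / (derivative P).eval (ξ n)) (n : ℕ) :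
    ξ n - x (Fin.last t) ≤
      ((∑ i ∈ Finset.univ.erase (Fin.last t), (ξ 0 - x (Fin.last t)) / (ξ 0 - x i)) / (1 + ∑ i ∈ Finset.univ.erase (Fin.last t), (ξ 0 - x (Fin.last t)) / (ξ 0 - x i))) ^ n * (ξ 0 - x (Fin.last t)) := by
  obtain ⟨c, hc⟩ : ∃ c : ℝ, c = ∑ i ∈ Finset.univ.erase (Fin.last t), (ξ 0 - x (Fin.last t)) / (ξ 0 - x i) := ⟨_, rfl⟩
  have hc0 : 0 ≤ c := by
    rw [hc]
    refine Finset.sum_nonneg fun i _ => div_nonneg (sub_pos.2 hξ0).le ?_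
    linarith [hx.monotone (Fin.le_last i)]
  have hθ0 : 0 ≤ c / (1 + c) := by positivity
  have hroot : P.eval (x (Fin.last t)) = 0 := by
    rw [hP, eval_prod]; exact Finset.prod_eq_zero (Finset.mem_univ (Fin.last t)) (by rw [eval_sub, eval_X, eval_C, sub_self])
  rw [← hc]
  induction n with
  | zero => rw [pow_zero, one_mul]
  | succ n ih =>
    obtain ⟨h1, h2, -⟩ := newton_iterates_mem hx hP hξ0 hstep n
    have hstepn : ξ (n + 1) - x (Fin.last t) ≤ c / (1 + c) * (ξ n - x (Fin.last t)) := by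
      rcases h1.eq_or_lt with h | h
      · rw [hstep n, ← h, hroot, zero_div, sub_zero, sub_self, mul_zero]
      · rw [hstep n, hc]; exact newton_step_contraction hx hP h h2
    calc ξ (n + 1) - x (Fin.last t) ≤ c / (1 + c) * (ξ n - x (Fin.last t)) := hstepn
      _ ≤ c / (1 + c) * ((c / (1 + c)) ^ n * (ξ 0 - x (Fin.last t))) := mul_le_mul_of_nonneg_left ih hθ0
      _ = (c / (1 + c)) ^ (n + 1) * (ξ 0 - x (Fin.last t)) := by ring

/-- **NEWTON FROM THE RIGHT CONVERGES TO THE LARGEST ZERO: `ξ_n → x_t`.** [Stoer–Bulirsch Thm 5.5.5; Ostrowski Ch. 9; this file, §1115] -/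
theorem newton_iterates_tendsto {P : ℝ[X]} {t : ℕ} {x : Fin (t + 1) → ℝ} (hx : StrictMono x) (hP : P = ∏ j, (Polynomial.X - C (x j)))
    {ξ : ℕ → ℝ} (hξ0 : x (Fin.last t) < ξ 0) (hstep : ∀ n, ξ (n + 1) = ξ n - P.eval (ξ n) / (derivative P).eval (ξ n)) :
    Tendsto ξ atTop (𝓝 (x (Fin.last t))) := by
  obtain ⟨c, hc⟩ : ∃ c : ℝ, c = ∑ i ∈ Finset.univ.erase (Fin.last t), (ξ 0 - x (Fin.last t)) / (ξ 0 - x i) := ⟨_, rfl⟩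
  have hc0 : 0 ≤ c := by
    rw [hc]
    refine Finset.sum_nonneg fun i _ => div_nonneg (sub_pos.2 hξ0).le ?_
    linarith [hx.monotone (Fin.le_last i)]
  have hθ0 : 0 ≤ c / (1 + c) := by positivity
  have hθ1 : c / (1 + c) < 1 := by rw [div_lt_one (by positivity)]; linarith
  -- the error is squeezed between `0` and `θⁿ (ξ₀ − x_t)`
  have hlow : ∀ n, 0 ≤ ξ n - x (Fin.last t) := fun n => sub_nonneg.2 (newton_iterates_mem hx hP hξ0 hstep n).1
  have hup : ∀ n, ξ n - x (Fin.last t) ≤ (c / (1 + c)) ^ n * (ξ 0 - x (Fin.last t)) := fun n => by rw [hc]; exact newton_iterates_geometric hx hP hξ0 hstep n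
  have hgeo : Tendsto (fun n => (c / (1 + c)) ^ n * (ξ 0 - x (Fin.last t))) atTop (𝓝 0) := by
    have := (tendsto_pow_atTop_nhds_zero_of_lt_one hθ0 hθ1).mul_const (ξ 0 - x (Fin.last t))
    rwa [zero_mul] at this
  have herr : Tendsto (fun n => ξ n - x (Fin.last t)) atTop (𝓝 0) := tendsto_of_tendsto_of_tendsto_of_le_of_le tendsto_const_nhds hgeo hlow hup
  have := herr.add_const (x (Fin.last t))
  simpa using this

end Summit.Ventures.HSemireg.Wedge.HankelOuter
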